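import Literature.MathematicalPhysics.QuantumFieldTheory.Balaban1983to89.B9Eq325RLipschitzSqrtTowerLinear

/-!
# `Balaban1983to89.B9Eq325RLipschitzSqrtTowerPackaged` — T. Bałaban, *Propagators for lattice gauge theories in a background field*, Commun. Math. Phys. **99**
# (1985) 389–434 [Balaban1985BackgroundPropagators] p. 403 with (3.25) p. 394, (3.35)–(3.37) p. 396, Thm 3.11 p. 416 AT `k = n+1` AVERAGING LEVELS ON PRINT's
# DIAGONAL `ηL^{n+1} = 1`: **THE `k`-LEVEL `R`-LETTER PACKAGED — `∃ α_R C_R > 0` (closed in `(d, L, M_φ, M_φ′, r)`) BEFORE EVERY LATTICE ∕ HEIGHT ∕ WEIGHT ∕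
# VOLUME ∕ BACKGROUND BINDER, THEN `‖R_k(U)f − R_k(1)f‖ ≤ C_R·α·‖f‖`** — ne9-leaf-04's `B9Eq325RLipschitzSqrtTowerLinear.norm_RofUk_sub_RofUk_one_le_diagonal_linear`
# (slopes and floors at the threshold bound by definitional equalities, three windows) with its threshold staging done ONCE: the `hR` slot of every `k`-level
# diagonal theorem of the NE9 chain inhabited by one `obtain`

statement-level skeleton of published theorems with citation tags; proofs where landed; nothing here is a claim about the Yang–Mills mass gap

CITATION HEADER (lean-in-tree rule).  Audit cell `pub-balaban`, sub-cell `t4`, BINDER row NE9; filed by NE9 formalisation-swarm leaf prover 03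
(`b2b-balaban-t4-ne9-formalise-leaf-03`, gen 66), INTENT I-ne9leaf03-g66-B.  The LETTER is ne9-leaf-04's (gen 75, `B9Eq325RLipschitzSqrtTowerLinear`); the two
private arithmetic letters of §1 are the row OWNER's (t4-ne9-p1 gen 85, `B9Thm311SmallFieldCoercivityTowerClosed` §1, private there; copied a second time in
ne9-leaf-04 gen 76's staged `B9Eq386GreenLipschitzEnergyClosed`); the OWNER's X-read note on that file (journal, INFO I-1): *«if a fourth consumer appears the
three should move to one public arithmetic file»* — the `C_R` slots of `B9Eq353FormDefectTowerDiagonal` (4a) and `B9Eq3126H1kLipschitzEnergyDiagonal`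
(INTENT-6) are the fourth and fifth consumers; this is that file.  Sources READ in the held text `paper:balaban1985-cmp99-background-propagators` pp. 394, 396,
403, 416.  Objects BY NAME: `RofUk`, `UlevOf`, `adTransportW`; nothing re-declared, 0 `def`.

THE PRINT (verbatim).  p. 403 l. 27–28: *«These results imply that the operators R(U), P(U) = I − R(U) extend analytically to the domain (3.37) and satisfy
the same bounds»*; p. 396 (3.35)–(3.37): the η-scaled small-field class and the profile of the averaged configurations.

WHAT IS PROVED (sorry-free; proof lane — 0 `def`; [folklore] threshold arithmetic over ne9-leaf-04's landed letter; nothing of [B9] asserted as printed).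
* §1 (private) `gamma_m_ge`, `sA_le_bar` — the OWNER's two arithmetic letters (`γ_m ≥ 1∕8` at `a′ = 1` in the windows `s_Dα₀ ≤ 1`, `s_Qα₀ ≤ 1`,
  `2s_Dα₀ + 3s_Qα₀ ≤ 1∕8`; `s_A ≤ S̄ = 2(48s_D + 192s_Q) + 4s_Q`).
* §2 **`exists_norm_RofUk_sub_RofUk_one_le_diagonal`** — for the block size `L`, the fibre letters `M_φ, M_φ′` and a profile ratio `0 ≤ r < 1` THERE ARE
  `α_R, C_R > 0` (`C_R = 3S̄∕s♯ + 1`, `s♯ = (12d(6∕5)^{d−1} + 1)⁻¹`; `α_R = min(1∕(c + s_Q + s_D + 1), 1∕(16s_D + 24s_Q + 1), s♯∕(2S̄ + 1))`,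
  `c = d(L−1)·2M_φM_φ′∕(1−r)`) such that for EVERY `n`, `η` (`ηL^{n+1} = 1`), `c₀, c₁` (`c₀(L^{n+1})^d = c₁`), `m`, background `U` with mutually adjoint
  transporters (`hRS`), `U(b) ∈ U1`, `‖U(b) − 1‖ ≤ αη`, level averages `Ū^j(b) ∈ U1`, `‖Ū^j(b) − 1‖ ≤ ε_j` with `ε_j ≤ αr^j` (`j < n+1`), and `0 ≤ α ≤ α_R`:
  **`‖R_k(U)f − R_k(1)f‖ ≤ C_R·α·‖f‖`** for every `f` — NO `η`, NO volume, NO number of levels in `C_R` (block-size dependent, as print's constants).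
HONEST SCOPE.  [folklore]; the small-field windows and `hRS` stay HYPOTHESES; crude constants; «NE9 ⇐ the named binders»; NE9 NOT PRINTED ∕ NOT PROVED; NOT
summit progress (cell pub-balaban: row NE9 WALLED ON A MODEL (O-NE9-1; #5 UNRULED); spine PROVED 0∕9; rung (B)+1 finite T⁴ — NOT infinite volume, NOT mass gap,
NOT BetaPertH, NOT Clay; HONEST DEPENDENCY: continuum YM on T⁴ ⇐ BetaPertH ∧ nine spine estimates (0/9 proved); BetaPertH ⇐ (D1) ∧ (D4) ∧ CAP+tail; G-an2-4
gates asym, D1 and NE2/3/4).  NEW file importing `B9Eq325RLipschitzSqrtTowerLinear` only; nothing modified.  Net new unproved facts: 0.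
-/

noncomputable section

open scoped InnerProductSpace ComplexConjugate BigOperators

namespace Literature.MathematicalPhysics.QuantumFieldTheory.Balaban1983to89.B9Eq325RLipschitzSqrtTowerPackaged

open B9SectCLatticeCarrier (Bond)
open B7Prop1Explicit (U1)
open B11Eq103H1Complex (SiteL2K)
open B9Eq310HessianOperator (adTransportW)
open B9Eq315QTower (towerP UlevOf)
open B9Eq326OperatorTower (RofUk)
open B9Eq325RLipschitzSqrtTowerLinear (norm_RofUk_sub_RofUk_one_le_diagonal_linear)

/-! ## §1 Two arithmetic letters (the OWNER's `B9Thm311SmallFieldCoercivityTowerClosed` §1, private there) -/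

/-- The auxiliary site coercivity at the threshold stays above `1∕8` (at `a′ = 1`: `γ_f = 1∕4`) when `s_Dα₀ ≤ 1`, `s_Qα₀ ≤ 1` and
`2s_Dα₀ + 3s_Qα₀ ≤ 1∕8`. [folklore] -/
private theorem gamma_m_ge {sD sQ α₀ θb γm : ℝ} (hsD : 0 ≤ sD) (hsQ : 0 ≤ sQ) (hα : 0 ≤ α₀)
    (h3 : 2 * (sD * α₀) + 3 * (sQ * α₀) ≤ 1 / 8) (hθb : θb = sQ * α₀)
    (hγm : γm = 1 / (2 + 2 / (1 : ℝ)) - (sD * α₀ + (sD * α₀) ^ 2 + (1 : ℝ) * θb * (2 * 1 + θb))) : 1 / 8 ≤ γm := by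
  have pD : 0 ≤ sD * α₀ := mul_nonneg hsD hα
  have pQ : 0 ≤ sQ * α₀ := mul_nonneg hsQ hα
  have h1 : sD * α₀ ≤ 1 := by linarith
  have e1 : (sD * α₀) ^ 2 ≤ sD * α₀ := by
    rw [sq]; exact (mul_le_mul_of_nonneg_left h1 pD).trans (by rw [mul_one])
  have e2 : (1 : ℝ) * θb * (2 * 1 + θb) ≤ 3 * (sQ * α₀) := by
    rw [one_mul, hθb]
    have : 2 * 1 + sQ * α₀ ≤ 3 := by linarith
    calc sQ * α₀ * (2 * 1 + sQ * α₀) ≤ sQ * α₀ * 3 := mul_le_mul_of_nonneg_left this pQ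
      _ = 3 * (sQ * α₀) := by ring
  have hq : (1 : ℝ) / (2 + 2 / 1) = 1 / 4 := by norm_num
  rw [hγm, hq]
  linarith

/-- The slope letter `s_A` at the threshold is below `S̄ = 2(48s_D + 192s_Q) + 4s_Q` once `γ_m ≥ 1∕8` and `θ̄ ≤ 1`. [folklore] -/
private theorem sA_le_bar {sD sQ θb γm sG sA : ℝ} (hsD : 0 ≤ sD) (hsQ : 0 ≤ sQ) (hθb0 : 0 ≤ θb) (hθb1 : θb ≤ 1) (hγm : 1 / 8 ≤ γm)
    (hsG : sG = 2 * sD * (γm⁻¹ * (Real.sqrt γm)⁻¹) + (|(1 : ℝ)| * sQ * ((1 + θb) + 1)) * γm⁻¹ ^ 2)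
    (hsA : sA = sG * (1 + θb) + (2 + 2 / (1 : ℝ)) * sQ) : sA ≤ 2 * (48 * sD + 192 * sQ) + 4 * sQ := by
  have hγm0 : 0 < γm := lt_of_lt_of_le (by norm_num) hγm
  have hγinv : γm⁻¹ ≤ 8 := by rw [inv_le_comm₀ hγm0 (by norm_num)]; linarith
  have hγsqrt : (Real.sqrt γm)⁻¹ ≤ 3 := by
    have hs : Real.sqrt (1 / 8) ≤ Real.sqrt γm := Real.sqrt_le_sqrt hγm
    have h18 : (1 : ℝ) / 3 ≤ Real.sqrt (1 / 8) := by
      rw [show (1 : ℝ) / 3 = Real.sqrt ((1 / 3) ^ 2) by rw [Real.sqrt_sq (by norm_num)]]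
      exact Real.sqrt_le_sqrt (by norm_num)
    have hpos : 0 < Real.sqrt γm := Real.sqrt_pos.2 hγm0
    rw [inv_le_comm₀ hpos (by norm_num)]
    linarith
  have hγinv0 : 0 ≤ γm⁻¹ := by positivity
  have hγsqrt0 : 0 ≤ (Real.sqrt γm)⁻¹ := by positivity
  have hsGle : sG ≤ 48 * sD + 192 * sQ := by
    rw [hsG, abs_one, one_mul]
    have h1 : γm⁻¹ * (Real.sqrt γm)⁻¹ ≤ 8 * 3 := mul_le_mul hγinv hγsqrt hγsqrt0 (by norm_num)
    have h2 : γm⁻¹ ^ 2 ≤ 8 ^ 2 := pow_le_pow_left₀ hγinv0 hγinv 2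
    have h3 : (1 + θb) + 1 ≤ 3 := by linarith
    have h4 : 2 * sD * (γm⁻¹ * (Real.sqrt γm)⁻¹) ≤ 2 * sD * (8 * 3) := mul_le_mul_of_nonneg_left h1 (by positivity)
    have h5 : sQ * ((1 + θb) + 1) * γm⁻¹ ^ 2 ≤ sQ * 3 * 8 ^ 2 :=
      mul_le_mul (mul_le_mul_of_nonneg_left h3 hsQ) h2 (by positivity) (by positivity)
    linarith
  have hsG0 : 0 ≤ sG := by rw [hsG]; positivity
  have h1 : sG * (1 + θb) ≤ (48 * sD + 192 * sQ) * 2 := mul_le_mul hsGle (by linarith) (by positivity) (by positivity)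
  have hq : (2 : ℝ) + 2 / 1 = 4 := by norm_num
  rw [hsA, hq]
  linarith

/-! ## §2 The `k`-level `R`-letter with `∃ α_R C_R` before every binder -/

section Exists

variable {d : ℕ} (L : ℕ) [NeZero L] {𝔸 : Type*} [NormedRing 𝔸] [NormedAlgebra ℂ 𝔸] [CompleteSpace 𝔸] [NormOneClass 𝔸]
  {W : Type*} [NormedAddCommGroup W] [InnerProductSpace ℂ W] [FiniteDimensional ℂ W] (φ : W ≃ₗ[ℂ] 𝔸)
  {Mφ Mφ' : ℝ} (hMφ : 0 ≤ Mφ) (hMφ' : 0 ≤ Mφ') (hφ : ∀ w, ‖φ w‖ ≤ Mφ * ‖w‖) (hφ' : ∀ X, ‖φ.symm X‖ ≤ Mφ' * ‖X‖) {r : ℝ} (hr0 : 0 ≤ r) (hr1 : r < 1)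

include hMφ hMφ' hφ hφ' hr0 hr1

/-- **THE `k`-LEVEL `R`-LETTER, PACKAGED**: for the block size `L`, the fibre letters `M_φ, M_φ′` and a profile ratio `0 ≤ r < 1` there are `α_R, C_R > 0`
(closed in `(d, L, M_φ, M_φ′, r)`) such that for every `n`, `η` (`ηL^{n+1} = 1`), `c₀, c₁` (`c₀(L^{n+1})^d = c₁`), `m`, background `U` and profile `εU ≥ 0`
with `‖Ū^j(b) − 1‖ ≤ ε_j`, `Ū^j(b) ∈ U1`, every `0 ≤ α ≤ α_R` with `hRS`, `U(b) ∈ U1`, `‖U(b) − 1‖ ≤ αη`, `ε_j ≤ αr^j` (`j < n+1`), and every `f`: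
`‖R_k(U)f − R_k(1)f‖ ≤ C_R·α·‖f‖` — ne9-leaf-04's α-linear letter at the auxiliary site penalty `a′ = 1` with its slopes at `α_R`, the three windows of
the letter folded into `α_R` (`C_R = 3S̄∕s♯ + 1 ≥ 3s_A∕s♯`).  No `η`, no volume, no number of levels in `C_R`. [cite: Balaban1985BackgroundPropagators, p.403, (3.25) p.394, (3.35)–(3.37) p.396, Thm 3.11 p.416] -/
theorem exists_norm_RofUk_sub_RofUk_one_le_diagonal :
    ∃ αR CR : ℝ, 0 < αR ∧ 0 < CR ∧ ∀ (n : ℕ) (η : ℝ), η * (L : ℝ) ^ (n + 1) = 1 →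
      ∀ (c₀ c₁ : ℝ) [Fact (0 < c₀)] [Fact (0 < c₁)], c₀ * ((L : ℝ) ^ (n + 1)) ^ d = c₁ →
      ∀ (m : Fin d → ℕ) [∀ i, NeZero (m i)] (U : Bond d (towerP L m (n + 1)) → 𝔸ˣ) (εU : ℕ → ℝ), (∀ j, 0 ≤ εU j) →
        (∀ (j : ℕ) (b : Bond d (towerP L m (j + 1))), ‖(UlevOf L m (n + 1) U j b : 𝔸) - 1‖ ≤ εU j) →
        (∀ (j : ℕ) (b : Bond d (towerP L m (j + 1))), UlevOf L m (n + 1) U j b ∈ U1 𝔸) →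
      ∀ {α : ℝ}, 0 ≤ α → α ≤ αR →
        (∀ (b : Bond d (towerP L m (n + 1))) (v u : W), ⟪adTransportW φ U b v, u⟫_ℂ = ⟪v, adTransportW φ (fun b => (U b)⁻¹) b u⟫_ℂ) →
        (∀ b, U b ∈ U1 𝔸) → (∀ b, ‖(U b : 𝔸) - 1‖ ≤ α * η) → (∀ j < n + 1, εU j ≤ α * r ^ j) →
        ∀ f : SiteL2K ℂ d (towerP L m (n + 1)) c₀ W,
          ‖RofUk L m n φ η U (c₀ := c₀) f - RofUk L m n φ η (fun _ : Bond d (towerP L m (n + 1)) => (1 : 𝔸ˣ)) (c₀ := c₀) f‖ ≤ CR * α * ‖f‖ := by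
  have h1r : 0 < 1 - r := by linarith
  -- the closed letters of the `R`-letter (K = 2M_φM_φ′; the (3.25) representation at the auxiliary site penalty a′ = 1)
  obtain ⟨sD, hsDdef⟩ : ∃ sD : ℝ, sD = Real.sqrt d * (2 * Mφ * Mφ') := ⟨_, rfl⟩
  have hsD : 0 ≤ sD := by rw [hsDdef]; positivity
  obtain ⟨cc, hccdef⟩ : ∃ cc : ℝ, cc = ((d * (L - 1) : ℕ) : ℝ) * (2 * Mφ * Mφ') / (1 - r) := ⟨_, rfl⟩
  have hcc : 0 ≤ cc := by rw [hccdef]; positivity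
  obtain ⟨sQ, hsQdef⟩ : ∃ sQ : ℝ, sQ = 2 * (((d * (L - 1) : ℕ) : ℝ) * (2 * Mφ * Mφ') / (1 - r)) := ⟨_, rfl⟩
  have hsQ : 0 ≤ sQ := by rw [hsQdef]; positivity
  obtain ⟨sS, hsSdef⟩ : ∃ sS : ℝ, sS = Real.sqrt (1 / (12 * (d : ℝ) * (6 / 5) ^ (d - 1) + 1) ^ 2) := ⟨_, rfl⟩
  have hsS : 0 < sS := by rw [hsSdef]; positivity
  obtain ⟨Sbar, hSbardef⟩ : ∃ Sbar : ℝ, Sbar = 2 * (48 * sD + 192 * sQ) + 4 * sQ := ⟨_, rfl⟩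
  have hSbar : 0 ≤ Sbar := by rw [hSbardef]; positivity
  -- the two windows of the letter and the window `2s_Aα ≤ s♯`
  obtain ⟨αR, hαRdef⟩ : ∃ αR : ℝ, αR = min (1 / (cc + sQ + sD + 1)) (min (1 / (16 * sD + 24 * sQ + 1)) (sS / (2 * Sbar + 1))) := ⟨_, rfl⟩
  have hαR0 : 0 < αR := by rw [hαRdef]; exact lt_min (by positivity) (lt_min (by positivity) (by positivity))
  refine ⟨αR, 3 * Sbar / sS + 1, hαR0, by positivity, ?_⟩
  intro n η hηL c₀ c₁ _ _ hw m _ U εU hεU hUε hLb α hα0 hαle hRS hUb hUη hεg f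
  have hαRa : αR ≤ 1 / (cc + sQ + sD + 1) := by rw [hαRdef]; exact min_le_left _ _
  have hαRb : αR ≤ 1 / (16 * sD + 24 * sQ + 1) := by rw [hαRdef]; exact (min_le_right _ _).trans (min_le_left _ _)
  have hαRS : αR ≤ sS / (2 * Sbar + 1) := by rw [hαRdef]; exact (min_le_right _ _).trans (min_le_right _ _)
  -- stage 1: the windows at α_R
  have pQ : 0 ≤ sQ * αR := mul_nonneg hsQ hαR0.le
  have pD : 0 ≤ sD * αR := mul_nonneg hsD hαR0.le
  have pc : 0 ≤ cc * αR := mul_nonneg hcc hαR0.le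
  have hA : αR * (cc + sQ + sD + 1) ≤ 1 := by
    have h := mul_le_mul_of_nonneg_right hαRa (by positivity : 0 ≤ cc + sQ + sD + 1)
    rwa [one_div, inv_mul_cancel₀ (by positivity : cc + sQ + sD + 1 ≠ 0)] at h
  have eA : αR * (cc + sQ + sD + 1) = cc * αR + sQ * αR + sD * αR + αR := by ring
  rw [eA] at hA
  have hc1 : cc * αR ≤ 1 := by linarith
  have hθb1 : sQ * αR ≤ 1 := by linarith
  have hB : αR * (16 * sD + 24 * sQ + 1) ≤ 1 := by
    have h := mul_le_mul_of_nonneg_right hαRb (by positivity : 0 ≤ 16 * sD + 24 * sQ + 1)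
    rwa [one_div, inv_mul_cancel₀ (by positivity : 16 * sD + 24 * sQ + 1 ≠ 0)] at h
  have eB : αR * (16 * sD + 24 * sQ + 1) = 16 * (sD * αR) + 24 * (sQ * αR) + αR := by ring
  rw [eB] at hB
  have h3 : 2 * (sD * αR) + 3 * (sQ * αR) ≤ 1 / 8 := by linarith
  -- the letters at α_R (a′ = 1), opaque names with definitional equalities
  obtain ⟨θb, hθbdef⟩ : ∃ θb : ℝ, θb = sQ * αR := ⟨_, rfl⟩
  obtain ⟨γm, hγmdef⟩ : ∃ γm : ℝ, γm = 1 / (2 + 2 / (1 : ℝ)) - (sD * αR + (sD * αR) ^ 2 + (1 : ℝ) * θb * (2 * 1 + θb)) := ⟨_, rfl⟩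
  obtain ⟨sG, hsGdef⟩ : ∃ sG : ℝ, sG = 2 * sD * (γm⁻¹ * (Real.sqrt γm)⁻¹) + (|(1 : ℝ)| * sQ * ((1 + θb) + 1)) * γm⁻¹ ^ 2 := ⟨_, rfl⟩
  obtain ⟨sA, hsAdef⟩ : ∃ sA : ℝ, sA = sG * (1 + θb) + (2 + 2 / (1 : ℝ)) * sQ := ⟨_, rfl⟩
  have hθb0 : 0 ≤ θb := by rw [hθbdef]; exact pQ
  have hθble : θb ≤ 1 := by rw [hθbdef]; exact hθb1
  have hγm : 1 / 8 ≤ γm := gamma_m_ge hsD hsQ hαR0.le h3 hθbdef hγmdef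
  have hγm0 : 0 < γm := lt_of_lt_of_le (by norm_num) hγm
  -- stage 2: s_A ≤ S̄, hence the window `2s_Aα_R ≤ s♯` and `3s_A∕s♯ ≤ C_R`
  have hsAle : sA ≤ Sbar := by rw [hSbardef]; exact sA_le_bar hsD hsQ hθb0 hθble hγm hsGdef hsAdef
  have hsG0 : 0 ≤ sG := by rw [hsGdef]; positivity
  have hsA0 : 0 ≤ sA := by rw [hsAdef]; positivity
  have hwin : 2 * sA * αR ≤ sS := by
    have h1 : 2 * sA * αR ≤ 2 * Sbar * (sS / (2 * Sbar + 1)) :=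
      mul_le_mul (mul_le_mul_of_nonneg_left hsAle (by norm_num)) hαRS hαR0.le (by positivity)
    have h2 : 2 * Sbar * (sS / (2 * Sbar + 1)) ≤ sS := by
      rw [mul_div_assoc', div_le_iff₀ (by positivity)]
      have e : sS * (2 * Sbar + 1) = 2 * Sbar * sS + sS := by ring
      rw [e]; linarith [hsS.le]
    exact h1.trans h2
  have hCRle : 3 * sA / sS ≤ 3 * Sbar / sS + 1 :=
    (div_le_div_of_nonneg_right (by linarith) hsS.le).trans (le_add_of_nonneg_right zero_le_one)
  -- the letter BY NAME (a′ = 1, slopes at α_R), then weakened to the fixed constant `C_R`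
  have h := norm_RofUk_sub_RofUk_one_le_diagonal_linear L m n φ hMφ hMφ' hφ hφ' c₀ η c₁ (one_pos : (0 : ℝ) < 1) hηL hw U hRS hα0 hUb hUη
    εU hεU hUε hLb hr0 hr1 hαle hεg hsDdef hsQdef hθbdef hγmdef hsGdef hsAdef hsSdef (by rw [← hccdef]; exact hc1) hγm0 hwin f
  exact h.trans (mul_le_mul_of_nonneg_right (mul_le_mul_of_nonneg_right hCRle hα0) (norm_nonneg _))

end Exists

end Literature.MathematicalPhysics.QuantumFieldTheory.Balaban1983to89.B9Eq325RLipschitzSqrtTowerPackaged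

end
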